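import Literature.AlgebraicGeometry.Resolution.Lipman1969RationalSurfaceSingularities
import Literature.AlgebraicGeometry.Resolution.Blowups
import Literature.AlgebraicGeometry.Resolution.BlowupsFlatBaseChange
import Literature.AlgebraicGeometry.Resolution.ExceptionalFibreConnected
import Literature.AlgebraicGeometry.Resolution.TwoChartBlowupCechH1
import Literature.AlgebraicGeometry.Resolution.RegularLocalRingTwoChartInput
import Literature.AlgebraicGeometry.Resolution.BlowupClosedPointRegularSurface
import Literature.AlgebraicGeometry.Resolution.ResolutionWithoutExceptionalCurves
import Literature.AlgebraicGeometry.Resolution.ResolutionFactorsThroughBlowup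
import Literature.AlgebraicGeometry.Resolution.ResolutionClosedPointCartier
import Literature.AlgebraicGeometry.Resolution.ExceptionalCurvesLocalizedResolution
import Literature.AlgebraicGeometry.Resolution.CechH1LerayRegularBirational
import HarnessLib

/-!
# `H¹(X, 𝒪_X) = 0` for every resolution `X → Spec R` of a two-dimensional REGULAR local ring
# (Lipman 1969, Proposition (1.2) 2) in the regular case — a THEOREM, not a named fact)

Topic: `Literature/AlgebraicGeometry/Resolution`; sibling of `RationalSurfaceSingularitiesBasic.lean`, whose
`Lipman1969_1_2.hasTrivialCechH1_of_isResolution` is the same statement MODULO the named fact `Lipman1969_1_2` and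
for any rational `R`.  ASSEMBLY at universe `u` (OPTION Ⅱ) of the F-79 «2-reg» sub-cell of the D-0154 (2) RES
inputs cell: the planner's skeleton `F79_2reg_BRICKS_SKELETON.lean` (res-inputs-plan-1; statement = frozen
candidate c81c3a1e93c43cdb, critic R58 (5) PASS) with every brick replaced BY NAME by a tree theorem —
(S0) `exists_map_maximalIdeal_ΓSpec_eq_span_regularPair`, (A0) `IsBlowup.hasTrivialCechH1_of_ideal_eq_span_pair`,
(Y) `isRegular_of_isBlowup_closedPoint_of_isRegularLocalRing`, (E3)
`hasTrivialCechH1_of_isResolution_of_excCurvePoints_eq_empty`, (F1)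
`exists_factor_through_blowup_closedPoint_of_isEffectiveCartier` ∘
`isEffectiveCartier_comap_of_isResolution_of_excCurvePoints_nonempty` (res-inputs-p-7a, res-inputs-p-9a),
(M) `isResolution_pullback_fromSpecStalk_and_ncard_excCurvePoints_lt`, (L)
`hasTrivialCechH1_comp_of_isBirational_of_forall_stalk` (res-inputs-p-9c).  AI-written, weaker than expert
review.  The universe-`0` Summits-side twin (OPTION Ⅰ, the spelling the W4.4 Genus-line consumers call) is
`Summit.….Theorems.SurfaceTermination.TwoRegular.hasTrivialCechH1_of_isResolution_of_isRegularLocalRing`.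

Source, read on the page (J. Lipman, Publ. Math. IHÉS 36 (1969); PDF page = printed page − 193):
* Definition (1.1), p. 199, L36–38: «A normal local ring R of dimension 2 is said to have a rational singularity
  if there exists a desingularization f : X → Spec(R) such that H¹(X, 𝒪_X) = 0.  Note that if R is regular then R
  has a rational singularity (take X = Spec(R)).»
* Proposition (1.2), p. 199, L40–45: «Let R be a two-dimensional normal local ring having a rational
  singularity, and let g : W → Spec(R) be a birational map of finite type. … 2) If W is normal and g is proper
  then H¹(W, 𝒪_W) = 0.»
* Proof, p. 200: A) «If X is any regular surface and j : Z → X is a quadratic transformation, then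
  H¹(Z, 𝒪_Z) ≅ H¹(X, 𝒪_X)» (two-chart Čech computation, L44–69); B) domination by a product of quadratic
  transformations (Thm. (26.1)); induction.

PROOF HERE (fact-free; Zariski factorisation + Leray, one blow-up of the closed point at a time; strong induction
on the number `#excCurvePoints π` of integral exceptional curves, uniformly in the regular local ring): no
exceptional curve ⇒ `π` is an isomorphism and `X` is affine (E3); otherwise `𝔪 = (u, v)` (S0), the blow-up
`bl : Y₁ → Spec R` of the closed point is a regular surface (Y) with `Ȟ¹(Y₁, 𝒪) = 0` by Lipman's two-chart
computation (A0), `𝔪𝒪_X` is invertible so `π = ρ ≫ bl` with `ρ` proper birational (F1); at each closed point `y`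
of the exceptional curve the localised `ρ_y` is a resolution of the regular `𝒪_{Y₁,y}` with fewer exceptional
curves (M), so `Ȟ¹ = 0` there by induction, and Leray with this pointwise input (L) gives `Ȟ¹(X, 𝒪) = 0`.

HONEST SCOPE: the named fact `Lipman1969_1_2` (rational non-regular `R`; part 1); arbitrary normal `W`) STAYS
PRINT — this file discharges only its regular special case; no summit statement is proved; resolution of
singularities in dim ≥ 4 / char p is NOT proved.
-/

noncomputable section

open CategoryTheory CategoryTheory.Limits AlgebraicGeometry TopologicalSpace IsLocalRing
open Literature.AlgebraicGeometry.Morphisms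

universe u

namespace Literature.AlgebraicGeometry.Resolution

/-- **Lipman (1.2) 2) for a REGULAR base — the induction** (the skeleton's `two_reg_of_bricks`): for `T`
regular local of dimension `2` and `π : X → Spec T` a resolution, `Ȟ¹(𝒰, 𝒪_X) = 0` for every finite affine open
cover `𝒰` of `X`, by strong induction on the number of integral exceptional curves, peeling one blow-up of the
closed point off the base at a time. [cite: Lipman1969, Proposition (1.2) 2) (p. 199) with Definition (1.1)] -/
theorem hasTrivialCechH1_of_isResolution_of_isRegularLocalRing_aux {T : Type u} [CommRing T]
    [IsRegularLocalRing T] (hT : ringKrullDim T = 2) {X : Scheme.{u}} (π : X ⟶ Spec (.of T))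
    (hπ : IsResolution π) : HasTrivialCechH1 π := by
  suffices H : ∀ (n : ℕ) (T : Type u) [CommRing T] [IsRegularLocalRing T], ringKrullDim T = 2 →
      ∀ (X : Scheme.{u}) (π : X ⟶ Spec (.of T)), IsResolution π →
        (excCurvePoints π).ncard = n → HasTrivialCechH1 π from
    H _ T hT X π hπ rfl
  intro n
  induction n using Nat.strong_induction_on with
  | _ n ih =>
  intro T _ _ hT X π hπ hn
  by_cases hne : (excCurvePoints π).Nonempty
  swap
  · exact hasTrivialCechH1_of_isResolution_of_excCurvePoints_eq_empty hT π hπ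
      (Set.not_nonempty_iff_eq_empty.mp hne)
  -- the ideal sheaf of the closed point of `Spec T`
  set J : Ideal Γ(Spec (.of T), ⊤) :=
    Ideal.map (Scheme.ΓSpecIso (.of T)).inv.hom (maximalIdeal T) with hJ
  obtain ⟨I, hI⟩ : ∃ I : (Spec (.of T)).IdealSheafData, I.ideal ⟨⊤, isAffineOpen_top _⟩ = J := by
    refine ⟨Scheme.IdealSheafData.ofIdealTop J, ?_⟩
    have h := (Scheme.IdealSheafData.equivOfIsAffine (X := Spec (.of T))).apply_symm_apply J
    rwa [Scheme.IdealSheafData.equivOfIsAffine_symm_apply,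
      Scheme.IdealSheafData.equivOfIsAffine_apply] at h
  -- its blow-up `bl : Y₁ → Spec T`, a regular surface (Y)
  obtain ⟨Y₁, bl, hbl⟩ := exists_isBlowup (Spec (.of T)) I
  obtain ⟨hint, hnoeth, hblprop, hreg, hdim⟩ :=
    isRegular_of_isBlowup_closedPoint_of_isRegularLocalRing hT I hI bl hbl
  -- `Ȟ¹(Y₁, 𝒪) = 0` by Lipman's two-chart computation (A0) on a regular pair generating `𝔪` (S0)
  obtain ⟨u, v, hspan, hu, huv, hv, hvu⟩ := exists_map_maximalIdeal_ΓSpec_eq_span_regularPair hT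
  have hY1 : HasTrivialCechH1 bl :=
    IsBlowup.hasTrivialCechH1_of_ideal_eq_span_pair hbl ⟨⊤, isAffineOpen_top _⟩ rfl (hI.trans hspan)
      hu huv hv hvu bl
  -- `π` factors through `bl` (F1): `𝔪𝒪_X` is invertible
  obtain ⟨ρ, hfac, hρprop, hρbir⟩ := exists_factor_through_blowup_closedPoint_of_isEffectiveCartier hT π hπ
    I hI (isEffectiveCartier_comap_of_isResolution_of_excCurvePoints_nonempty hT π hπ I hI hne) bl hbl
  -- `X` is Noetherian (proper over `Spec T`)
  haveI : IsProper π := hπ.isProper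
  haveI : IsNoetherian X := by
    haveI : IsLocallyNoetherian X := LocallyOfFiniteType.isLocallyNoetherian π
    haveI : CompactSpace X := QuasiCompact.compactSpace_of_compactSpace π
    exact {}
  -- pointwise vanishing at the dimension-two points of `Y₁`, by (M) and the induction hypothesis
  have hpt : ∀ y : Y₁, ringKrullDim (Y₁.presheaf.stalk y) = 2 →
      HasTrivialCechH1 (pullback.snd ρ (Y₁.fromSpecStalk y)) := by
    intro y hy
    obtain ⟨hres, hlt⟩ :=
      isResolution_pullback_fromSpecStalk_and_ncard_excCurvePoints_lt hT π hπ I hI bl hbl ρ hfac hρbir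
        y hy (pullback.snd ρ (Y₁.fromSpecStalk y)) rfl
    haveI : IsRegularLocalRing (Y₁.presheaf.stalk y) := hreg y
    exact ih _ (hn ▸ hlt) _ hy _ _ hres rfl
  -- Leray with the pointwise input (L)
  have h := hasTrivialCechH1_comp_of_isBirational_of_forall_stalk bl ρ hρbir hπ.isRegular hreg hdim hpt hY1
  rwa [hfac] at h

/-- **Lipman 1969, Proposition (1.2) 2) for a REGULAR two-dimensional local ring** (with the note after
Definition (1.1): «if `R` is regular then `R` has a rational singularity (take `X = Spec(R)`)»): for `R` a regular
local ring of Krull dimension `2` and `π : X → Spec R` a resolution of singularities (`π` proper and birational,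
`X` regular), `H¹(X, 𝒪_X) = 0` — in Čech form, `Ȟ¹(𝒰, 𝒪_X) = 0` for every finite affine open cover `𝒰` of `X`
(`HasTrivialCechH1 π`).  Print (verbatim, Prop. (1.2)): «Let `R` be a two-dimensional normal local ring having a
rational singularity, and let `g : W → Spec(R)` be a birational map of finite type. … 2) If `W` is normal and `g`
is proper then `H¹(W, 𝒪_W) = 0`.» — our `W := X` is regular, hence normal, and `g := π` is proper birational.
Fact-free special case of the named fact `Lipman1969_1_2`, part 2) (which itself stays PRINT); statement = frozen
candidate c81c3a1e93c43cdb.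
[cite: Lipman1969, Proposition (1.2) 2) (p. 199, PDF p. 6 L40–45) with Definition (1.1) (p. 199, L36–38); proof A)–B) (p. 200, PDF p. 7 L5–69)] -/
theorem hasTrivialCechH1_of_isResolution_of_isRegularLocalRing
    {R : Type u} [CommRing R] [IsRegularLocalRing R] (hdim : ringKrullDim R = 2)
    {X : Scheme.{u}} (π : X ⟶ Spec (.of R)) (hπ : IsResolution π) :
    HasTrivialCechH1 π :=
  hasTrivialCechH1_of_isResolution_of_isRegularLocalRing_aux hdim π hπ

end Literature.AlgebraicGeometry.Resolution

end
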